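import Mathlib.Analysis.Fourier.Convolution
import Mathlib.Analysis.Fourier.Inversion
import Mathlib.Probability.Distributions.Cauchy
import Literature.Analysis.SpecialFunctions.FermiKernelPositivity
import Literature.Analysis.SpecialFunctions.SechCosineTransform
import HarnessLib

/-!
# The three kernels of Lieb–Wu's integral equations: Cauchy `K`, Fermi `u`, sech `r`

For `c > 0` (in the application `c = U/4`) let

* `K_c(x) = c/(π(c² + x²))` (`cauchyDensity c`, the Cauchy law of scale `c`; Lieb–Wu's `K̂` has
  kernel `K_{U/4}` and `K̂²` has kernel `K_{U/2}`),
* `u_c(x) = π⁻¹ ∫₀^∞ cos(ωx) dω/(1 + e^{2cω})` (`fermiKernel c`, the kernel of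
  `Û = K̂²(1 + K̂²)⁻¹`; `u ≥ 0` and `∫ u = 1/2` by `FermiKernelPositivity`),
* `r_c(x) = sech(πx/2c)/(2c)` (`sechKernel c`, the kernel of `R̂ = 2K̂(1 + K̂²)⁻¹`; `r > 0`,
  `∫ r = 1`).

This file proves their Fourier transforms (Mathlib's `𝓕`, kernel `e^{-2πixξ}`):
`𝓕 K_c = e^{-2πc|ξ|}` (`fourier_cauchyDensity`, by inversion from `𝓕 e^{-2πc|·|} = K_c`),
`𝓕 u_c = 1/(1 + e^{4πc|ξ|})` (`fourier_fermiKernel`), `𝓕 r_c = sech(2πcξ)` (`fourier_sechKernel`),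
and from them, by the `L¹` convolution theorem and the injectivity of `𝓕` on continuous integrable
functions, the three CONVOLUTION IDENTITIES that encode Lieb–Wu's operator algebra
`Û(1 + K̂²) = K̂²`, `R̂ + 2ÛK̂ = 2K̂`, `K̂R̂ = 2Û` (Physica A 321 (2003) 1, §5, eq. (U) and the
proof of Theorem 1) at the level of kernels:

* `integral_fermiKernel_mul_cauchyDensity_two_mul`: `∫ u_c(t) K_{2c}(z - t) dt = K_{2c}(z) - u_c(z)`;
* `integral_fermiKernel_mul_cauchyDensity`: `∫ u_c(t) K_c(z - t) dt = K_c(z) - r_c(z)/2`;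
* `integral_sechKernel_mul_cauchyDensity`: `∫ r_c(t) K_c(z - t) dt = 2 u_c(z)`.

Finally `integral_fermiKernel_sub_sin`: `∫_{-π/2}^{π/2} u_c(x - sin θ) dθ = I(2c, x)`
(`fermiCosJ0`, Fubini and Bessel's integral), so that Lieb–Wu's Lemma 5
(`BesselJZeroFermiIntegral.two_mul_fermiCosJ0_lt`) reads
`∫_{-π/2}^{π/2} u_c(x - sin θ) dθ < 1/(2√(1 - x²))` for `|x| < 1` (`integral_fermiKernel_sub_sin_lt`).

## Purpose

These identities let one manipulate the (finite-measure versions of the) Lieb–Wu integral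
equations without any operator theory: they are the inputs of the contraction ("bootstrap")
argument identifying the thermodynamic limit of the Lieb–Wu root distributions at half filling
(movement 2 of Goldbaum, CMP 258 (2005) 317, §5; see the module docstring of
`Literature.MathematicalPhysics.QuantumLattice.LiebWuRho0Bounds`).

## References

* E. H. Lieb, F. Y. Wu, Physica A 321 (2003) 1–27 = arXiv:cond-mat/0207529, §5 (operators `K̂`,
  `R̂`, `Û`, eq. (U), "the integral kernel of `R̂` is … `sech`, which is positive", "`Û` has a
  positive kernel", `‖Û‖ = 1/2`) and §6 (`ρ₀`, Lemma 5).
* Mathlib: `Real.fourier_mul_convolution_eq` (convolution theorem), `Continuous.fourierInv_fourier_eq`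
  (inversion), `Real.fourierInv_eq_fourier_neg`, `ProbabilityTheory.cauchyPDFReal`
  (`integral_cauchyPDFReal_eq_one`), `BddAbove.continuous_convolution_right_of_integrable`,
  `MeasureTheory.Integrable.integrable_convolution`.
-/

noncomputable section


open MeasureTheory Set Filter Real
open scoped Topology FourierTransform Convolution

namespace Literature.Analysis.SpecialFunctions

/-! ### General Fourier lemmas on `ℝ` -/

/-- The Fourier transform of a real, even, integrable function is its cosine transform:
`𝓕 f(ξ) = ∫ f(x) cos(2π x ξ) dx`. [folklore] -/
theorem fourier_ofReal_eq_integral_cos {f : ℝ → ℝ} (hf : Integrable f) (heven : ∀ x, f (-x) = f x)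
    (ξ : ℝ) :
    𝓕 (fun x => (f x : ℂ)) ξ = ((∫ x, f x * Real.cos (2 * π * x * ξ) : ℝ) : ℂ) := by
  rw [Real.fourier_real_eq_integral_exp_smul]
  have hsplit : (fun v : ℝ => Complex.exp (↑(-2 * π * v * ξ) * Complex.I) • ((f v : ℝ) : ℂ)) =
      fun v => ((f v * Real.cos (2 * π * v * ξ) : ℝ) : ℂ) +
        ((-(f v * Real.sin (2 * π * v * ξ)) : ℝ) : ℂ) * Complex.I := by
    funext v
    simp only [smul_eq_mul]
    rw [Complex.exp_mul_I, ← Complex.ofReal_cos, ← Complex.ofReal_sin]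
    have : (-2 * π * v * ξ : ℝ) = -(2 * π * v * ξ) := by ring
    rw [this, Real.cos_neg, Real.sin_neg]
    push_cast
    ring
  rw [hsplit]
  have hi1 : Integrable fun v : ℝ => ((f v * Real.cos (2 * π * v * ξ) : ℝ) : ℂ) := by
    refine (Integrable.mono' hf.norm (hf.aestronglyMeasurable.mul (by fun_prop)) ?_).ofReal
    exact Eventually.of_forall fun v => by
      simp only [Pi.mul_apply, Real.norm_eq_abs, abs_mul]
      exact mul_le_of_le_one_right (abs_nonneg _) (Real.abs_cos_le_one _)
  have hi2 : Integrable fun v : ℝ =>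
      ((-(f v * Real.sin (2 * π * v * ξ)) : ℝ) : ℂ) * Complex.I := by
    refine (Integrable.ofReal ?_).mul_const _
    refine (Integrable.mono' hf.norm (hf.aestronglyMeasurable.mul (by fun_prop)) ?_).neg
    exact Eventually.of_forall fun v => by
      simp only [Pi.mul_apply, Real.norm_eq_abs, abs_mul]
      exact mul_le_of_le_one_right (abs_nonneg _) (Real.abs_sin_le_one _)
  have hsin : ∫ v : ℝ, f v * Real.sin (2 * π * v * ξ) = 0 := by
    set B : ℝ → ℝ := fun v => f v * Real.sin (2 * π * v * ξ) with hB
    have h1 : ∫ v, B v = ∫ v, B (-v) := (integral_neg_eq_self B volume).symm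
    have h2 : (fun v => B (-v)) = fun v => -B v := by
      funext v
      simp only [hB, heven]
      rw [show 2 * π * -v * ξ = -(2 * π * v * ξ) by ring, Real.sin_neg]
      ring
    rw [h2, integral_neg] at h1
    linarith
  rw [integral_add hi1 hi2, integral_mul_const, integral_complex_ofReal, integral_complex_ofReal,
    integral_neg, hsin]
  simp

/-- Additivity of the Fourier transform of integrable functions on `ℝ`, pointwise. [folklore] -/
theorem fourier_add_apply {f g : ℝ → ℂ} (hf : Integrable f) (hg : Integrable g) (ξ : ℝ) :
    𝓕 (f + g) ξ = 𝓕 f ξ + 𝓕 g ξ := by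
  have := VectorFourier.fourierIntegral_add Real.continuous_fourierChar
    (L := innerₗ ℝ) continuous_inner hf hg
  exact congrFun this ξ

/-- Homogeneity of the Fourier transform on `ℝ`, pointwise. [folklore] -/
theorem fourier_const_mul_apply (f : ℝ → ℂ) (a : ℂ) (ξ : ℝ) :
    𝓕 (fun x => a * f x) ξ = a * 𝓕 f ξ := by
  have := VectorFourier.fourierIntegral_const_smul Real.fourierChar volume (innerₗ ℝ) f a
  exact congrFun this ξ

/-- **Injectivity of the Fourier transform on continuous integrable functions** (from Fourier
inversion): two continuous integrable functions on `ℝ` with the same Fourier transform are equal.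
[folklore] -/
theorem eq_of_fourier_eq_of_continuous {f g : ℝ → ℂ} (hfc : Continuous f) (hgc : Continuous g)
    (hf : Integrable f) (hg : Integrable g) (h : 𝓕 f = 𝓕 g) : f = g := by
  have hsub : 𝓕 (f - g) = 0 := by
    ext ξ
    have : f - g = f + fun x => (-1 : ℂ) * g x := by
      funext x; simp; ring
    rw [this, fourier_add_apply hf (hg.const_mul _), fourier_const_mul_apply, h]
    simp
  have hinv := (hfc.sub hgc).fourierInv_fourier_eq (hf.sub hg)
    (by rw [hsub]; exact integrable_zero _ _ _)
  rw [hsub] at hinv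
  have h0 : (𝓕⁻ (0 : ℝ → ℂ)) = 0 := by
    ext w
    rw [Real.fourierInv_eq]
    simp
  rw [h0] at hinv
  exact (sub_eq_zero.1 hinv.symm)

/-- `𝓕 f(ξ) = 𝓕⁻ f(-ξ)`, so an even function that is the Fourier transform of `g` has Fourier
transform `g`: if `g` is continuous and integrable with integrable transform, then
`𝓕 (𝓕 g) ξ = g (-ξ)`. [folklore] -/
theorem fourier_fourier_eq_apply_neg {g : ℝ → ℂ} (hgc : Continuous g) (hg : Integrable g)
    (hFg : Integrable (𝓕 g)) (ξ : ℝ) : 𝓕 (𝓕 g) ξ = g (-ξ) := by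
  have h1 : 𝓕 (𝓕 g) ξ = 𝓕⁻ (𝓕 g) (-ξ) := by
    rw [Real.fourierInv_eq_fourier_neg, neg_neg]
  rw [h1, hgc.fourierInv_fourier_eq hg hFg]


/-! ### The Cauchy kernel `K_c(x) = c/(π(c² + x²))` and its Fourier transform -/

/-- The Cauchy (Poisson) kernel `K_c(x) = c / (π (c² + x²))`, the density of the Cauchy law of
scale `c` (Mathlib's `ProbabilityTheory.cauchyPDFReal 0 c` for `c ≥ 0`). In Lieb–Wu's notation
(Physica A 321 (2003) 1, §5) the operator `K̂` has kernel `K_{U/4}` and `K̂²` has kernel `K_{U/2}`.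
[cite: LiebWuPhysicaA2003, §5] -/
def cauchyDensity (c x : ℝ) : ℝ := c / (π * (c ^ 2 + x ^ 2))

/-- `K_c` is Mathlib's Cauchy density of location `0` and scale `c`. [folklore] -/
theorem cauchyDensity_eq_cauchyPDFReal {c : ℝ} (hc : 0 ≤ c) (x : ℝ) :
    cauchyDensity c x = ProbabilityTheory.cauchyPDFReal 0 ⟨c, hc⟩ x := by
  rw [cauchyDensity, ProbabilityTheory.cauchyPDFReal_def]
  show c / (π * (c ^ 2 + x ^ 2)) = π⁻¹ * c * ((x - 0) ^ 2 + c ^ 2)⁻¹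
  rw [sub_zero, div_eq_mul_inv, mul_inv, add_comm]
  ring

/-- `K_c` is even. [folklore] -/
theorem cauchyDensity_neg (c x : ℝ) : cauchyDensity c (-x) = cauchyDensity c x := by
  simp [cauchyDensity]

/-- `K_c > 0` for `c > 0`. [folklore] -/
theorem cauchyDensity_pos {c : ℝ} (hc : 0 < c) (x : ℝ) : 0 < cauchyDensity c x := by
  unfold cauchyDensity; positivity

/-- `K_c ≤ 1/(πc)`. [folklore] -/
theorem cauchyDensity_le {c : ℝ} (hc : 0 < c) (x : ℝ) : cauchyDensity c x ≤ 1 / (π * c) := by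
  rw [cauchyDensity, div_le_div_iff₀ (by positivity) (by positivity)]
  nlinarith [sq_nonneg x, Real.pi_pos]

/-- `K_c` is continuous (`c > 0`). [folklore] -/
theorem continuous_cauchyDensity {c : ℝ} (hc : 0 < c) : Continuous (cauchyDensity c) := by
  unfold cauchyDensity
  exact continuous_const.div (by fun_prop) fun x => by positivity

/-- `K_c` is integrable. [folklore] -/
theorem integrable_cauchyDensity {c : ℝ} (hc : 0 ≤ c) : Integrable (cauchyDensity c) := by
  have : cauchyDensity c = ProbabilityTheory.cauchyPDFReal 0 ⟨c, hc⟩ :=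
    funext fun x => cauchyDensity_eq_cauchyPDFReal hc x
  rw [this]
  exact ProbabilityTheory.integrable_cauchyPDFReal 0

/-- `∫ K_c = 1` (`c > 0`). [folklore] -/
theorem integral_cauchyDensity {c : ℝ} (hc : 0 < c) : ∫ x, cauchyDensity c x = 1 := by
  have : cauchyDensity c = ProbabilityTheory.cauchyPDFReal 0 ⟨c, hc.le⟩ :=
    funext fun x => cauchyDensity_eq_cauchyPDFReal hc.le x
  rw [this]
  exact ProbabilityTheory.integral_cauchyPDFReal_eq_one 0
    (show (0 : NNReal) < ⟨c, hc.le⟩ from hc).ne'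

/-- `𝓕(e^{-a|·|})(ξ) = 2a/(a² + (2πξ)²)`, written as the Cauchy kernel when `a = 2πc`:
`𝓕(e^{-2πc|·|}) = K_c`. [folklore] -/
theorem fourier_exp_neg_two_pi_mul_abs {c : ℝ} (hc : 0 < c) (ξ : ℝ) :
    𝓕 (fun x : ℝ => (Real.exp (-(2 * π * c * |x|)) : ℂ)) ξ = (cauchyDensity c ξ : ℂ) := by
  have ha : 0 < 2 * π * c := by positivity
  rw [fourier_ofReal_eq_integral_cos (integrable_exp_neg_mul_abs ha) (fun x => by rw [abs_neg]) ξ]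
  congr 1
  set A : ℝ → ℝ := fun x => Real.exp (-(2 * π * c * |x|)) * Real.cos (2 * π * x * ξ) with hA
  have hAi : Integrable A := by
    refine Integrable.mono' (integrable_exp_neg_mul_abs ha) (by fun_prop) (Eventually.of_forall fun x => ?_)
    simp only [hA, Real.norm_eq_abs, abs_mul, abs_of_pos (Real.exp_pos _)]
    exact mul_le_of_le_one_right (Real.exp_pos _).le (Real.abs_cos_le_one _)
  have hsplit := integral_add_compl (measurableSet_Ioi (a := (0 : ℝ))) hAi
  change ∫ x, A x = _
  rw [← hsplit, compl_Ioi]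
  have hneg : ∫ x in Iic (0:ℝ), A x = ∫ x in Ioi (0:ℝ), A x := by
    rw [← neg_zero, ← integral_comp_neg_Ioi (f := A)]
    simp only [neg_zero]
    refine setIntegral_congr_fun measurableSet_Ioi fun x _ => ?_
    simp only [hA, abs_neg]
    rw [show 2 * π * -x * ξ = -(2 * π * x * ξ) by ring, Real.cos_neg]
  rw [hneg, ← two_mul]
  have hI : ∫ x in Ioi (0:ℝ), A x = (2 * π * c) / ((2 * π * c) ^ 2 + (2 * π * ξ) ^ 2) := by
    rw [← integral_exp_neg_mul_cos ha (2 * π * ξ)]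
    refine setIntegral_congr_fun measurableSet_Ioi fun x hx => ?_
    simp only [hA, abs_of_pos (show (0:ℝ) < x from hx)]
    rw [show 2 * π * x * ξ = 2 * π * ξ * x by ring]
  rw [hI, cauchyDensity]
  have hπ := Real.pi_pos
  field_simp

/-- **Fourier transform of the Cauchy kernel**: `𝓕 K_c(ξ) = e^{-2πc|ξ|}` (`c > 0`), by Fourier
inversion from `𝓕(e^{-2πc|·|}) = K_c`. [folklore] -/
theorem fourier_cauchyDensity {c : ℝ} (hc : 0 < c) (ξ : ℝ) :
    𝓕 (fun x : ℝ => (cauchyDensity c x : ℂ)) ξ = (Real.exp (-(2 * π * c * |ξ|)) : ℂ) := by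
  have ha : 0 < 2 * π * c := by positivity
  set g : ℝ → ℂ := fun x => (Real.exp (-(2 * π * c * |x|)) : ℂ) with hg
  have hgc : Continuous g := by simp only [hg]; fun_prop
  have hgi : Integrable g := (integrable_exp_neg_mul_abs ha).ofReal
  have hFg : 𝓕 g = fun ξ => (cauchyDensity c ξ : ℂ) := funext fun ξ => fourier_exp_neg_two_pi_mul_abs hc ξ
  have hFgi : Integrable (𝓕 g) := by rw [hFg]; exact (integrable_cauchyDensity hc.le).ofReal
  rw [← hFg, fourier_fourier_eq_apply_neg hgc hgi hFgi, hg]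
  simp only [abs_neg]

/-! ### The Fermi kernel `u = π⁻¹ fermiCos(2c, ·)` (kernel of Lieb–Wu's `Û`) -/

/-- The kernel `u_c(x) = π⁻¹ ∫₀^∞ cos(ωx) dω/(1 + e^{2cω})` of Lieb–Wu's operator
`Û = K̂²/(1 + K̂²)` (Fourier multiplier `1/(1 + e^{4πc|ξ|})`; with `c = U/4` this is
`1/(1 + e^{U|ω|/2})` in the variable `ω = 2πξ`). Lieb–Wu, Physica A 321 (2003) 1, §5, proof of
Theorem 1 and eq. (U). [cite: LiebWuPhysicaA2003, §5] -/
def fermiKernel (c x : ℝ) : ℝ := π⁻¹ * fermiCos (2 * c) x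

/-- `u_c` is even. [folklore] -/
theorem fermiKernel_neg (c x : ℝ) : fermiKernel c (-x) = fermiKernel c x := by
  simp [fermiKernel, fermiCos, mul_neg, Real.cos_neg]

/-- `u_c ≥ 0` (Pólya; `fermiCos_nonneg`): "`Û` has a positive kernel". [cite: LiebWuPhysicaA2003, §5] -/
theorem fermiKernel_nonneg {c : ℝ} (hc : 0 < c) (x : ℝ) : 0 ≤ fermiKernel c x := by
  unfold fermiKernel
  have := fermiCos_nonneg (by positivity : 0 < 2 * c) x
  positivity

/-- `u_c ≤ 1/(2πc)`. [folklore] -/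
theorem fermiKernel_le {c : ℝ} (hc : 0 < c) (x : ℝ) : fermiKernel c x ≤ 1 / (2 * π * c) := by
  unfold fermiKernel
  have h := fermiCos_le_inv (by positivity : 0 < 2 * c) x
  have hπ := Real.pi_pos
  calc π⁻¹ * fermiCos (2 * c) x ≤ π⁻¹ * (1 / (2 * c)) := by gcongr
    _ = 1 / (2 * π * c) := by field_simp

/-- `u_c` is continuous. [folklore] -/
theorem continuous_fermiKernel {c : ℝ} (hc : 0 < c) : Continuous (fermiKernel c) :=
  continuous_const.mul (continuous_fermiCos (by positivity))

/-- `u_c` is integrable. [folklore] -/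
theorem integrable_fermiKernel {c : ℝ} (hc : 0 < c) : Integrable (fermiKernel c) :=
  (integrable_fermiCos (by positivity)).const_mul _

/-- `∫ u_c = 1/2` (`= ‖Û‖`). [cite: LiebWuPhysicaA2003, §5] -/
theorem integral_fermiKernel {c : ℝ} (hc : 0 < c) : ∫ x, fermiKernel c x = 1 / 2 := by
  unfold fermiKernel
  rw [integral_const_mul, integral_fermiCos (by positivity)]
  have hπ := Real.pi_pos
  field_simp

/-- Scaling: `2 fermiCos(4πc, 2πx) = π⁻¹ fermiCos(2c, x)` (substitute `ω ↦ 2πω`). [folklore] -/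
theorem two_mul_fermiCos_two_pi {c : ℝ} (x : ℝ) :
    2 * fermiCos (4 * π * c) (2 * π * x) = fermiKernel c x := by
  unfold fermiKernel fermiCos
  have hπ : 0 < 2 * π := by positivity
  have hsub := integral_comp_mul_left_Ioi (fun t => Real.cos (t * x) * fermiFn (2 * c) t) 0 hπ
  simp only [mul_zero] at hsub
  have hfun : (fun ω : ℝ => Real.cos (ω * (2 * π * x)) * fermiFn (4 * π * c) ω) =
      fun ω => Real.cos ((2 * π * ω) * x) * fermiFn (2 * c) (2 * π * ω) := by
    funext ω
    simp only [fermiFn]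
    rw [show ω * (2 * π * x) = (2 * π * ω) * x by ring,
      show 4 * π * c * ω = 2 * c * (2 * π * ω) by ring]
  rw [hfun, hsub, smul_eq_mul, ← mul_assoc]
  congr 1
  field_simp

/-- `u_c` is the Fourier transform of the even Fermi profile `φ_{4πc}(|·|)`. [folklore] -/
theorem fermiKernel_eq_fourier_fermiAbs {c : ℝ} (hc : 0 < c) (x : ℝ) :
    (fermiKernel c x : ℂ) = 𝓕 (fermiAbs (4 * π * c)) x := by
  rw [fourier_fermiAbs (by positivity), two_mul_fermiCos_two_pi]

/-- **Fourier transform of the Fermi kernel**: `𝓕 u_c(ξ) = 1/(1 + e^{4πc|ξ|})`. [cite: LiebWuPhysicaA2003, §5, eq. (U)] -/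
theorem fourier_fermiKernel {c : ℝ} (hc : 0 < c) (ξ : ℝ) :
    𝓕 (fun x : ℝ => (fermiKernel c x : ℂ)) ξ = (fermiFn (4 * π * c) |ξ| : ℂ) := by
  have hC : 0 < 4 * π * c := by positivity
  have hfun : (fun x : ℝ => (fermiKernel c x : ℂ)) = 𝓕 (fermiAbs (4 * π * c)) :=
    funext fun x => fermiKernel_eq_fourier_fermiAbs hc x
  rw [hfun, fourier_fourier_eq_apply_neg (continuous_fermiAbs _) (integrable_fermiAbs hC)
    (integrable_fourier_fermiAbs hC)]
  simp [fermiAbs, abs_neg]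

/-! ### The sech kernel `r` (kernel of Lieb–Wu's `R̂ = 2K̂(1 + K̂²)⁻¹`) -/

/-- The kernel `r_c(x) = sech(πx/(2c))/(2c)` of Lieb–Wu's operator `R̂` (Fourier multiplier
`sech(2πcξ)`, i.e. `sech(ωU/4)` in `ω = 2πξ` for `c = U/4`); Lieb–Wu: "the integral kernel of `R̂`
is `(2U)⁻¹ sech(2πx/U)` [in their scaling], which is positive". Physica A 321 (2003) 1, §5.
[cite: LiebWuPhysicaA2003, §5] -/
def sechKernel (c x : ℝ) : ℝ := 1 / (2 * c * Real.cosh (π * x / (2 * c)))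

/-- `r_c` is even. [folklore] -/
theorem sechKernel_neg (c x : ℝ) : sechKernel c (-x) = sechKernel c x := by
  simp [sechKernel, neg_div, mul_neg]

/-- `r_c > 0`: "the integral kernel of `R̂` … is positive". [cite: LiebWuPhysicaA2003, §5] -/
theorem sechKernel_pos {c : ℝ} (hc : 0 < c) (x : ℝ) : 0 < sechKernel c x := by
  unfold sechKernel
  have := Real.cosh_pos (π * x / (2 * c))
  positivity

/-- `r_c ≤ 1/(2c)`. [folklore] -/
theorem sechKernel_le {c : ℝ} (hc : 0 < c) (x : ℝ) : sechKernel c x ≤ 1 / (2 * c) := by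
  unfold sechKernel
  have h1 := Real.one_le_cosh (π * x / (2 * c))
  rw [div_le_div_iff₀ (by have := Real.cosh_pos (π * x / (2 * c)); positivity) (by positivity)]
  nlinarith

/-- `r_c` is continuous. [folklore] -/
theorem continuous_sechKernel {c : ℝ} (hc : 0 < c) : Continuous (sechKernel c) := by
  unfold sechKernel
  exact continuous_const.div (by fun_prop) fun x => by
    have := Real.cosh_pos (π * x / (2 * c)); positivity

/-- `r_c(x) ≤ c⁻¹ e^{-π|x|/(2c)}`. [folklore] -/
theorem sechKernel_le_exp {c : ℝ} (hc : 0 < c) (x : ℝ) :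
    sechKernel c x ≤ (1 / c) * Real.exp (-(π / (2 * c) * |x|)) := by
  have hb : 0 < π / (2 * c) := by positivity
  unfold sechKernel
  rw [show π * x / (2 * c) = π / (2 * c) * x by ring, ← Real.cosh_abs, abs_mul, abs_of_pos hb,
    Real.cosh_eq]
  set y := π / (2 * c) * |x| with hy
  have hy0 : 0 ≤ y := by positivity
  have hE := Real.exp_pos y
  have hE' := Real.exp_pos (-y)
  have hprod : Real.exp (-y) * Real.exp y = 1 := by rw [← Real.exp_add]; simp
  rw [div_le_iff₀ (by positivity)]
  have : 1 ≤ 1 / c * Real.exp (-y) * (2 * c * ((Real.exp y + Real.exp (-y)) / 2)) := by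
    have : 1 / c * Real.exp (-y) * (2 * c * ((Real.exp y + Real.exp (-y)) / 2)) =
        Real.exp (-y) * Real.exp y + Real.exp (-y) ^ 2 := by field_simp
    rw [this, hprod]
    nlinarith [sq_nonneg (Real.exp (-y))]
  linarith

/-- `r_c` is integrable. [folklore] -/
theorem integrable_sechKernel {c : ℝ} (hc : 0 < c) : Integrable (sechKernel c) := by
  refine Integrable.mono' ((integrable_exp_neg_mul_abs (by positivity : 0 < π / (2 * c))).const_mul
    (1 / c)) (continuous_sechKernel hc).aestronglyMeasurable (Eventually.of_forall fun x => ?_)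
  rw [Real.norm_eq_abs, abs_of_pos (sechKernel_pos hc x)]
  exact sechKernel_le_exp hc x

/-- The cosine transform of `r_c`: `∫ r_c(x) cos(ωx) dx = sech(cω)`. [folklore] -/
theorem integral_sechKernel_mul_cos {c : ℝ} (hc : 0 < c) (ω : ℝ) :
    ∫ x, sechKernel c x * Real.cos (ω * x) = 1 / Real.cosh (c * ω) := by
  have hb : 0 < π / (2 * c) := by positivity
  have h := integral_univ_cos_div_cosh hb ω
  have hfun : (fun x => sechKernel c x * Real.cos (ω * x)) =
      fun x => (1 / (2 * c)) * (Real.cos (ω * x) / Real.cosh (π / (2 * c) * x)) := by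
    funext x
    simp only [sechKernel]
    rw [show π * x / (2 * c) = π / (2 * c) * x by ring]
    field_simp
  rw [hfun, integral_const_mul, h]
  have hπ := Real.pi_pos
  have h1 : π / (π / (2 * c)) = 2 * c := by field_simp
  have h2 : π * ω / (2 * (π / (2 * c))) = c * ω := by field_simp
  rw [h1, h2]
  field_simp

/-- `∫ r_c = 1`. [folklore] -/
theorem integral_sechKernel {c : ℝ} (hc : 0 < c) : ∫ x, sechKernel c x = 1 := by
  have h := integral_sechKernel_mul_cos hc 0
  simp only [zero_mul, Real.cos_zero, mul_one, mul_zero, Real.cosh_zero, div_one] at h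
  exact h

/-- **Fourier transform of the sech kernel**: `𝓕 r_c(ξ) = sech(2πcξ)`. [cite: LiebWuPhysicaA2003, §5] -/
theorem fourier_sechKernel {c : ℝ} (hc : 0 < c) (ξ : ℝ) :
    𝓕 (fun x : ℝ => (sechKernel c x : ℂ)) ξ = ((1 / Real.cosh (2 * π * c * ξ) : ℝ) : ℂ) := by
  rw [fourier_ofReal_eq_integral_cos (integrable_sechKernel hc) (sechKernel_neg c) ξ]
  congr 1
  have hfun : (fun x => sechKernel c x * Real.cos (2 * π * x * ξ)) =
      fun x => sechKernel c x * Real.cos ((2 * π * ξ) * x) := by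
    funext x; rw [show 2 * π * x * ξ = (2 * π * ξ) * x by ring]
  rw [hfun, integral_sechKernel_mul_cos hc]
  rw [show c * (2 * π * ξ) = 2 * π * c * ξ by ring]

/-! ### Convolution identities between `K`, `u`, `r` (the operator identities
`Û(1 + K̂²) = K̂²`, `R̂ + 2ÛK̂ = 2K̂`, `K̂R̂ = 2Û` of Lieb–Wu 2003, §5, at the level of kernels) -/

/-- The multiplier identity behind `Û(1 + K̂²) = K̂²`: `φ(A) + φ(A) e^{-A} = e^{-A}` for the
Fermi function `φ(A) = 1/(1 + e^{A})`. [cite: LiebWuPhysicaA2003, §5, eq. (U)] -/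
theorem fermiFn_add_fermiFn_mul_exp (C a : ℝ) :
    fermiFn C a + fermiFn C a * Real.exp (-(C * a)) = Real.exp (-(C * a)) := by
  unfold fermiFn
  rw [Real.exp_neg]
  have hE := Real.exp_pos (C * a)
  field_simp
  ring

/-- The multiplier identity behind `R̂ + 2ÛK̂ = 2K̂`: `sech A + 2 φ(2A) e^{-A} = 2 e^{-A}`.
[cite: LiebWuPhysicaA2003, §5, eq. (U)] -/
theorem sech_add_two_mul_fermiFn_mul_exp (A : ℝ) :
    1 / Real.cosh A + 2 * (1 / (1 + Real.exp (2 * A)) * Real.exp (-A)) = 2 * Real.exp (-A) := by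
  rw [Real.cosh_eq, Real.exp_neg, show Real.exp (2 * A) = Real.exp A * Real.exp A by
    rw [← Real.exp_add]; ring_nf]
  have hE := Real.exp_pos A
  field_simp
  ring

/-- The multiplier identity behind `K̂R̂ = 2Û`: `e^{-A} sech A = 2 φ(2A)`.
[cite: LiebWuPhysicaA2003, §5, eq. (U)] -/
theorem exp_mul_sech_eq_two_mul_fermiFn (A : ℝ) :
    Real.exp (-A) * (1 / Real.cosh A) = 2 * (1 / (1 + Real.exp (2 * A))) := by
  rw [Real.cosh_eq, Real.exp_neg, show Real.exp (2 * A) = Real.exp A * Real.exp A by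
    rw [← Real.exp_add]; ring_nf]
  have hE := Real.exp_pos A
  field_simp
  ring

/-- The convolution of two real functions, complexified, is the complex convolution. [folklore] -/
theorem convolution_ofReal_apply (f g : ℝ → ℝ) (x : ℝ) :
    ((fun t => (f t : ℂ)) ⋆[ContinuousLinearMap.mul ℂ ℂ] fun t => (g t : ℂ)) x =
      ((∫ t, f t * g (x - t) : ℝ) : ℂ) := by
  rw [convolution_def]
  simp only [ContinuousLinearMap.mul_apply']
  rw [← integral_complex_ofReal]
  push_cast
  rfl

/-- Continuity and integrability of the convolution of an integrable function with a bounded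
continuous integrable one (complex-valued, on `ℝ`). [folklore] -/
theorem continuous_integrable_convolution {f g : ℝ → ℂ} (hf : Integrable f) (hg : Integrable g)
    (hgc : Continuous g) {B : ℝ} (hgB : ∀ x, ‖g x‖ ≤ B) :
    Continuous (f ⋆[ContinuousLinearMap.mul ℂ ℂ] g) ∧
      Integrable (f ⋆[ContinuousLinearMap.mul ℂ ℂ] g) := by
  refine ⟨?_, hf.integrable_convolution _ hg⟩
  refine BddAbove.continuous_convolution_right_of_integrable (L := ContinuousLinearMap.mul ℂ ℂ)
    ⟨B, ?_⟩ hf hgc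
  rintro _ ⟨x, rfl⟩
  exact hgB x

/-- **`u + u ∗ K_{2c} = K_{2c}`** (the kernel form of `Û(1 + K̂²) = K̂²`, i.e. `Û = K̂²(1 + K̂²)⁻¹`):
`∫ u_c(t) K_{2c}(z - t) dt = K_{2c}(z) - u_c(z)` for `c > 0` and all `z`. Proof: both sides are
continuous integrable functions of `z` with the same Fourier transform
(`φ(4πc|ξ|)(1 + e^{-4πc|ξ|}) = e^{-4πc|ξ|}`). [cite: LiebWuPhysicaA2003, §5, eq. (U)] -/
theorem integral_fermiKernel_mul_cauchyDensity_two_mul {c : ℝ} (hc : 0 < c) (z : ℝ) :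
    ∫ t, fermiKernel c t * cauchyDensity (2 * c) (z - t) = cauchyDensity (2 * c) z - fermiKernel c z := by
  have h2c : 0 < 2 * c := by positivity
  set uC : ℝ → ℂ := fun t => (fermiKernel c t : ℂ) with huC
  set KC : ℝ → ℂ := fun t => (cauchyDensity (2 * c) t : ℂ) with hKC
  have hui : Integrable uC := (integrable_fermiKernel hc).ofReal
  have hKi : Integrable KC := (integrable_cauchyDensity h2c.le).ofReal
  have huc : Continuous uC := Complex.continuous_ofReal.comp (continuous_fermiKernel hc)
  have hKc : Continuous KC := Complex.continuous_ofReal.comp (continuous_cauchyDensity h2c)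
  have hKB : ∀ x, ‖KC x‖ ≤ 1 / (π * (2 * c)) := fun x => by
    simp only [hKC, Complex.norm_real, Real.norm_eq_abs, abs_of_pos (cauchyDensity_pos h2c x)]
    exact cauchyDensity_le h2c x
  obtain ⟨hconv_c, hconv_i⟩ := continuous_integrable_convolution hui hKi hKc hKB
  -- `F := u + u ∗ K`, `G := K`
  have hFG : (uC + uC ⋆[ContinuousLinearMap.mul ℂ ℂ] KC) = KC := by
    refine eq_of_fourier_eq_of_continuous (huc.add hconv_c) hKc (hui.add hconv_i) hKi ?_
    ext ξ
    rw [fourier_add_apply hui hconv_i, Real.fourier_mul_convolution_eq hui hKi, huC, hKC,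
      fourier_fermiKernel hc, fourier_cauchyDensity h2c]
    have := fermiFn_add_fermiFn_mul_exp (4 * π * c) |ξ|
    rw [show 2 * π * (2 * c) * |ξ| = 4 * π * c * |ξ| by ring]
    exact_mod_cast this
  have hx := congrFun hFG z
  simp only [Pi.add_apply] at hx
  rw [huC, hKC, convolution_ofReal_apply] at hx
  beta_reduce at hx
  have hx' : fermiKernel c z + ∫ t, fermiKernel c t * cauchyDensity (2 * c) (z - t) =
      cauchyDensity (2 * c) z := by exact_mod_cast hx
  linarith

/-- **`r + 2 u ∗ K_c = 2 K_c`** (the kernel form of `R̂ = 2K̂ - 2ÛK̂ = 2K̂(1 + K̂²)⁻¹`):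
`∫ u_c(t) K_c(z - t) dt = K_c(z) - r_c(z)/2`. Fourier side: `sech A + 2φ(2A)e^{-A} = 2e^{-A}`,
`A = 2πc|ξ|`. [cite: LiebWuPhysicaA2003, §5, eq. (U)] -/
theorem integral_fermiKernel_mul_cauchyDensity {c : ℝ} (hc : 0 < c) (z : ℝ) :
    ∫ t, fermiKernel c t * cauchyDensity c (z - t) = cauchyDensity c z - sechKernel c z / 2 := by
  set uC : ℝ → ℂ := fun t => (fermiKernel c t : ℂ) with huC
  set KC : ℝ → ℂ := fun t => (cauchyDensity c t : ℂ) with hKC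
  set rC : ℝ → ℂ := fun t => (sechKernel c t : ℂ) with hrC
  have hui : Integrable uC := (integrable_fermiKernel hc).ofReal
  have hKi : Integrable KC := (integrable_cauchyDensity hc.le).ofReal
  have hri : Integrable rC := (integrable_sechKernel hc).ofReal
  have huc : Continuous uC := Complex.continuous_ofReal.comp (continuous_fermiKernel hc)
  have hKc : Continuous KC := Complex.continuous_ofReal.comp (continuous_cauchyDensity hc)
  have hrc : Continuous rC := Complex.continuous_ofReal.comp (continuous_sechKernel hc)
  have hKB : ∀ x, ‖KC x‖ ≤ 1 / (π * c) := fun x => by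
    simp only [hKC, Complex.norm_real, Real.norm_eq_abs, abs_of_pos (cauchyDensity_pos hc x)]
    exact cauchyDensity_le hc x
  obtain ⟨hconv_c, hconv_i⟩ := continuous_integrable_convolution hui hKi hKc hKB
  have h2i : Integrable fun x => (2 : ℂ) * (uC ⋆[ContinuousLinearMap.mul ℂ ℂ] KC) x :=
    hconv_i.const_mul _
  have h2c' : Continuous fun x => (2 : ℂ) * (uC ⋆[ContinuousLinearMap.mul ℂ ℂ] KC) x :=
    continuous_const.mul hconv_c
  -- `F := r + 2 (u ∗ K)`, `G := 2 K`
  have hFG : (rC + fun x => (2 : ℂ) * (uC ⋆[ContinuousLinearMap.mul ℂ ℂ] KC) x) =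
      fun x => (2 : ℂ) * KC x := by
    refine eq_of_fourier_eq_of_continuous (hrc.add h2c') (continuous_const.mul hKc) (hri.add h2i)
      (hKi.const_mul _) ?_
    ext ξ
    rw [fourier_add_apply hri h2i, fourier_const_mul_apply, fourier_const_mul_apply,
      Real.fourier_mul_convolution_eq hui hKi, huC, hKC, hrC,
      fourier_fermiKernel hc, fourier_cauchyDensity hc, fourier_sechKernel hc]
    have h := sech_add_two_mul_fermiFn_mul_exp (2 * π * c * |ξ|)
    have hcosh : Real.cosh (2 * π * c * ξ) = Real.cosh (2 * π * c * |ξ|) := by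
      rw [← Real.cosh_abs (2 * π * c * ξ), abs_mul, abs_of_pos (by positivity : 0 < 2 * π * c)]
    have hφ : fermiFn (4 * π * c) |ξ| = 1 / (1 + Real.exp (2 * (2 * π * c * |ξ|))) := by
      rw [fermiFn]; ring_nf
    rw [hcosh, hφ]
    exact_mod_cast h
  have hx := congrFun hFG z
  simp only [Pi.add_apply] at hx
  rw [huC, hKC, hrC, convolution_ofReal_apply] at hx
  beta_reduce at hx
  have hx' : sechKernel c z + 2 * ∫ t, fermiKernel c t * cauchyDensity c (z - t) =
      2 * cauchyDensity c z := by exact_mod_cast hx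
  linarith

/-- **`K_c ∗ r = 2u`** (the kernel form of `K̂R̂ = 2Û`): `∫ r_c(t) K_c(z - t) dt = 2 u_c(z)`.
Fourier side: `e^{-A} sech A = 2φ(2A)`, `A = 2πc|ξ|`. [cite: LiebWuPhysicaA2003, §5, eq. (U)] -/
theorem integral_sechKernel_mul_cauchyDensity {c : ℝ} (hc : 0 < c) (z : ℝ) :
    ∫ t, sechKernel c t * cauchyDensity c (z - t) = 2 * fermiKernel c z := by
  set uC : ℝ → ℂ := fun t => (fermiKernel c t : ℂ) with huC
  set KC : ℝ → ℂ := fun t => (cauchyDensity c t : ℂ) with hKC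
  set rC : ℝ → ℂ := fun t => (sechKernel c t : ℂ) with hrC
  have hui : Integrable uC := (integrable_fermiKernel hc).ofReal
  have hKi : Integrable KC := (integrable_cauchyDensity hc.le).ofReal
  have hri : Integrable rC := (integrable_sechKernel hc).ofReal
  have huc : Continuous uC := Complex.continuous_ofReal.comp (continuous_fermiKernel hc)
  have hKc : Continuous KC := Complex.continuous_ofReal.comp (continuous_cauchyDensity hc)
  have hKB : ∀ x, ‖KC x‖ ≤ 1 / (π * c) := fun x => by
    simp only [hKC, Complex.norm_real, Real.norm_eq_abs, abs_of_pos (cauchyDensity_pos hc x)]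
    exact cauchyDensity_le hc x
  obtain ⟨hconv_c, hconv_i⟩ := continuous_integrable_convolution hri hKi hKc hKB
  have hFG : (rC ⋆[ContinuousLinearMap.mul ℂ ℂ] KC) = fun x => (2 : ℂ) * uC x := by
    refine eq_of_fourier_eq_of_continuous hconv_c (continuous_const.mul huc) hconv_i (hui.const_mul _) ?_
    ext ξ
    rw [fourier_const_mul_apply, Real.fourier_mul_convolution_eq hri hKi, huC, hKC, hrC,
      fourier_fermiKernel hc, fourier_cauchyDensity hc, fourier_sechKernel hc]
    have h := exp_mul_sech_eq_two_mul_fermiFn (2 * π * c * |ξ|)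
    have hcosh : Real.cosh (2 * π * c * ξ) = Real.cosh (2 * π * c * |ξ|) := by
      rw [← Real.cosh_abs (2 * π * c * ξ), abs_mul, abs_of_pos (by positivity : 0 < 2 * π * c)]
    have hφ : fermiFn (4 * π * c) |ξ| = 1 / (1 + Real.exp (2 * (2 * π * c * |ξ|))) := by
      rw [fermiFn]; ring_nf
    rw [hcosh, hφ, mul_comm]
    exact_mod_cast h
  have hx := congrFun hFG z
  rw [hrC, hKC, huC, convolution_ofReal_apply] at hx
  beta_reduce at hx
  exact_mod_cast hx

/-! ### The Fermi kernel averaged over `sin θ`: `∫_{-π/2}^{π/2} u_c(x - sin θ) dθ = I(2c, x)` -/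

open Literature.Analysis.FunctionSpaces in
/-- `∫_{-π/2}^{π/2} cos(ω sin θ) dθ = π J₀(ω)` (Poisson/Bessel integral, `θ = φ - π/2`). [folklore] -/
theorem integral_cos_mul_sin_symm (ω : ℝ) :
    ∫ θ in (-(π / 2))..(π / 2), Real.cos (ω * Real.sin θ) = π * besselJ 0 ω := by
  have h := intervalIntegral.integral_comp_sub_right (fun θ => Real.cos (ω * Real.sin θ)) (π / 2)
    (a := 0) (b := π)
  have hfun : (fun φ : ℝ => Real.cos (ω * Real.sin (φ - π / 2))) = fun φ => Real.cos (ω * Real.cos φ) := by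
    funext φ
    rw [Real.sin_sub_pi_div_two, mul_neg, Real.cos_neg]
  simp only [hfun, zero_sub] at h
  rw [show π - π / 2 = π / 2 by ring] at h
  rw [← h, integral_cos_mul_cos_eq_pi_mul_besselJ_zero]

/-- `∫_{-π/2}^{π/2} sin(ω sin θ) dθ = 0` (odd integrand). [folklore] -/
theorem integral_sin_mul_sin_symm (ω : ℝ) :
    ∫ θ in (-(π / 2))..(π / 2), Real.sin (ω * Real.sin θ) = 0 := by
  have h := intervalIntegral.integral_comp_neg (fun θ => Real.sin (ω * Real.sin θ))
    (a := -(π / 2)) (b := π / 2)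
  simp only [Real.sin_neg, mul_neg, neg_neg] at h
  rw [intervalIntegral.integral_neg] at h
  linarith

/-- `∫_{-π/2}^{π/2} cos(ω(x - sin θ)) dθ = π J₀(ω) cos(ωx)`. [folklore] -/
theorem integral_cos_mul_sub_sin (ω x : ℝ) :
    ∫ θ in (-(π / 2))..(π / 2), Real.cos (ω * (x - Real.sin θ)) =
      π * Literature.Analysis.FunctionSpaces.besselJ 0 ω * Real.cos (ω * x) := by
  have hfun : (fun θ : ℝ => Real.cos (ω * (x - Real.sin θ))) = fun θ =>
      Real.cos (ω * x) * Real.cos (ω * Real.sin θ) + Real.sin (ω * x) * Real.sin (ω * Real.sin θ) := by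
    funext θ
    rw [mul_sub, Real.cos_sub]
  rw [hfun, intervalIntegral.integral_add ((by fun_prop : Continuous _).intervalIntegrable _ _)
    ((by fun_prop : Continuous _).intervalIntegrable _ _),
    intervalIntegral.integral_const_mul, intervalIntegral.integral_const_mul,
    integral_cos_mul_sin_symm, integral_sin_mul_sin_symm]
  ring

open Literature.Analysis.FunctionSpaces in
/-- **`∫_{-π/2}^{π/2} u_c(x - sin θ) dθ = I(2c, x) = ∫₀^∞ cos(xω) J₀(ω) dω/(1 + e^{2cω})`**
(Fubini and the Bessel integral): the Fermi kernel averaged over the momenta of a uniformly filled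
band is Lieb–Wu's integral `I`, so that `1/(2π) + (cos k) I(U/2, sin k) = ρ₀(k)`.
[cite: LiebWuPhysicaA2003, §6, formula for ρ₀(k)] -/
theorem integral_fermiKernel_sub_sin {c : ℝ} (hc : 0 < c) (x : ℝ) :
    ∫ θ in (-(π / 2))..(π / 2), fermiKernel c (x - Real.sin θ) = fermiCosJ0 (2 * c) x := by
  have h2c : 0 < 2 * c := by positivity
  -- the joint integrand and its domination by `e^{-2cω}`
  set I : ℝ → ℝ → ℝ := fun θ ω => Real.cos (ω * (x - Real.sin θ)) * fermiFn (2 * c) ω with hI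
  have hIcont : Continuous (Function.uncurry I) := by
    simp only [hI, Function.uncurry_def]
    have := continuous_fermiFn (2 * c)
    fun_prop
  haveI : IsFiniteMeasure (volume.restrict (Set.uIoc (-(π / 2)) (π / 2))) := by
    refine isFiniteMeasure_restrict.2 ?_
    simp [Set.uIoc, Real.volume_Ioc]
  have hg : Integrable (fun z : ℝ × ℝ => (1 : ℝ) * Real.exp (-(2 * c) * z.2))
      ((volume.restrict (Set.uIoc (-(π / 2)) (π / 2))).prod (volume.restrict (Ioi (0 : ℝ)))) :=
    Integrable.mul_prod (integrable_const 1) (exp_neg_integrableOn_Ioi 0 h2c)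
  have hF : Integrable (Function.uncurry I)
      ((volume.restrict (Set.uIoc (-(π / 2)) (π / 2))).prod (volume.restrict (Ioi (0 : ℝ)))) := by
    refine hg.mono' hIcont.aestronglyMeasurable (Filter.Eventually.of_forall fun z => ?_)
    rw [Function.uncurry_apply_pair, Real.norm_eq_abs, one_mul, hI]
    simp only [abs_mul, abs_of_pos (fermiFn_pos _ _)]
    calc |Real.cos (z.2 * (x - Real.sin z.1))| * fermiFn (2 * c) z.2 ≤ 1 * Real.exp (-(2 * c * z.2)) :=
          mul_le_mul (Real.abs_cos_le_one _) (fermiFn_le_exp_neg _) (fermiFn_pos _ _).le zero_le_one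
      _ = Real.exp (-(2 * c) * z.2) := by rw [one_mul, neg_mul]
  have hswap := MeasureTheory.intervalIntegral_integral_swap hF
  -- rewrite the left-hand side as the iterated integral
  have hpt : ∀ θ, fermiKernel c (x - Real.sin θ) = π⁻¹ * ∫ ω in Ioi (0 : ℝ), I θ ω := by
    intro θ
    simp only [fermiKernel, fermiCos, hI]
  simp_rw [hpt]
  rw [intervalIntegral.integral_const_mul]
  change π⁻¹ * ∫ θ in (-(π / 2))..(π / 2), ∫ ω in Ioi (0 : ℝ), Function.uncurry I (θ, ω) = _
  simp only [Function.uncurry_apply_pair] at hswap ⊢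
  rw [hswap]
  -- the inner `θ`-integral at fixed `ω`
  have hinner : ∀ ω ∈ Ioi (0 : ℝ), ∫ θ in (-(π / 2))..(π / 2), I θ ω =
      π * (Real.cos (x * ω) * besselJ 0 ω * fermiFn (2 * c) ω) := by
    intro ω _
    simp only [hI]
    rw [intervalIntegral.integral_mul_const, integral_cos_mul_sub_sin, mul_comm x ω]
    ring
  rw [setIntegral_congr_fun measurableSet_Ioi hinner, MeasureTheory.integral_const_mul, ← mul_assoc,
    inv_mul_cancel₀ Real.pi_pos.ne', one_mul, fermiCosJ0]
  refine setIntegral_congr_fun measurableSet_Ioi fun ω _ => ?_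
  rw [fermiFn]
  ring

/-- **The key inequality of the `k`-bootstrap (Lieb–Wu 2003, Lemma 5, in kernel form):** for
`c > 0` and `|x| < 1`, `∫_{-π/2}^{π/2} u_c(x - sin θ) dθ < 1/(2√(1 - x²))`, i.e. `Û` applied to
the arcsine density `1/(π√(1-s²))` stays below half of it. [cite: LiebWuPhysicaA2003, §6 Lemma 5] -/
theorem integral_fermiKernel_sub_sin_lt {c : ℝ} (hc : 0 < c) {x : ℝ} (hx : |x| < 1) :
    ∫ θ in (-(π / 2))..(π / 2), fermiKernel c (x - Real.sin θ) < 1 / (2 * √(1 - x ^ 2)) := by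
  rw [integral_fermiKernel_sub_sin hc]
  have h := two_mul_fermiCosJ0_lt (by positivity : 0 < 2 * c) hx
  have hs : 0 < √(1 - x ^ 2) := Real.sqrt_pos.2 (by nlinarith [abs_nonneg x, sq_abs x])
  have h2 : 1 / (2 * √(1 - x ^ 2)) = (1 / √(1 - x ^ 2)) / 2 := by field_simp
  rw [h2]
  linarith

end Literature.Analysis.SpecialFunctions
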